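import Literature.AlgebraicTopology.SingularHomology.LocalDegreeSum
import Literature.AlgebraicTopology.SingularHomology.TransverseDiscFunctional
import Literature.Topology.PlaneTopology.AnnulusLogarithm
import Literature.Analysis.Complex.ArgumentPrincipleWinding
import Literature.Topology.FourManifolds.ComplexProjectiveSpaceOrientationProofs
import HarnessLib

/-!
# The local degree of a plane map at an isolated preimage is the winding number

G. E. Bredon, *Topology and Geometry* (1993), IV.7 (Thm. 7.4, Cor. 7.5: the degree is the sum of
the local degrees over a finite good fibre; Example following Cor. 7.5, p. 193: *"`z ↦ zᵏ` … `k`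
points … the local degree at each of them is clearly `1`.  Consequently `deg(φₖ) = k`"*) and VI.11
(intersection numbers as sums of local indices); A. Hatcher, *Algebraic Topology* (2002), §2.2
Prop. 2.30 and §3.3 pp. 233–236.  For the tree's local homology (`Hₙ(X | x)`,
`HomologicalOrientation`, `…LocalDegreeLinearization`: the local degree at a non-degenerate point is
the sign of the Jacobian) we prove the planar local degree theorem at an ISOLATED, possibly
degenerate, preimage:

* `map_classAlong_eq_sum_detSign_smul` — (any dimension) pushing the orientation class along a
  compact `K ⊆ O` forward along `f : (O, O ∖ K) → (ℝⁿ, ℝⁿ ∖ q)` whose fibre over `q` is a finite set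
  of non-degenerate points gives `(Σ sign det Df) • g_q` (the second half of the proof of
  `sum_detSign_eq_zero`, Milnor TDV §6 / Hatcher Prop. 2.30);
* `map_classAlong_eq_of_eqOn` — two maps agreeing off `K` push that class to the same element
  (straight-line homotopy of pairs, Hatcher Prop. 2.19 for pairs);
* `map_openSubsetIso_inv_localClass_eq_map_classAlong` — the push-forward of the point class
  `g_p`, `p ∈ K`, along `t : (V, V ∖ p) → (ℝⁿ, ℝⁿ ∖ q)` is the push-forward of the class along `K`
  (excision and naturality);
* **`localDegree_eq_wind_smul_localClass`** — for `t : ℝ² ⊇ V → ℝ²` continuous with `p` the only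
  preimage of `q = t p` in `V`, and a closed disc of radius `r` about `p` inside `V` (discs and
  loops read in `ℂ` through any real-linear identification `ι : ℂ ≃L[ℝ] ℝ²`):
  `t_* g_p = wind (t ∘ (circle of radius r about p) - q) • g_q`.
  Proof (Bredon's example run backwards): with `w` the winding number and `N = |w|`, the map
  `(t - q) / ∏ⱼ (z - aⱼ)` (`N` points `aⱼ` near `p`; conjugate factors if `w < 0`) does not wind
  on the circle, so it has a logarithm `L` on an annulus (`hasLogOn_annulus_of_wind_eq_zero`);
  extending `L` radially to a function `L̃` constant near `p` gives the model
  `M = q + ∏ⱼ (z - aⱼ) · exp L̃`, equal to `t` on the annulus and with `N` non-degenerate preimages of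
  `q` of Jacobian sign `sign w`; the three displayed lemmas then give
  `t_* g_p = M_* g_K = (N · sign w) • g_q = w • g_q`.

Everything is proved; no definitions, no named facts.

## References

* G. E. Bredon, *Topology and Geometry*, GTM 139, Springer (1993), IV.7 Thm. 7.4, Cor. 7.5 and the
  Example following it (p. 193); VI.11. [Bredon1993]
* A. Hatcher, *Algebraic Topology*, CUP (2002), Prop. 2.19, Thm. 2.20, Prop. 2.30, §3.3
  pp. 233–236. [HatcherAT2002]
* J. Milnor, *Topology from the Differentiable Viewpoint* (1965), §6 Lemma 4. [MilnorTDV1965]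
-/

noncomputable section

open CategoryTheory Limits Set Metric Filter Function Complex
open scoped Topology unitInterval Real ComplexConjugate
open Literature.Topology.PlaneTopology

namespace Literature.AlgebraicTopology.SingularHomology

universe u

/-! ### Pushing the class along a compact set: finite non-degenerate fibre -/

section ClassAlong

variable {n : ℕ}

/-- **The push-forward of the orientation class along `K` through a finite non-degenerate fibre**
(Bredon 1993, IV.7 Thm. 7.4–Cor. 7.5; Hatcher 2002, Prop. 2.30; Milnor TDV §6 Lemma 4).  Let
`O ⊆ ℝⁿ` be open, `K ⊆ O` compact, `f` continuous on `O` with `f x ≠ q` for `x ∈ O` off the finite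
set `Z ⊆ K`, `f z = q` and `Df(z) = A z` invertible for `z ∈ Z`, and `α ∈ Hₙ(ℝⁿ | K)` a class
restricting to `g_z` at every `z ∈ Z`.  Then `f_*` of `α` (excised to `O`, a class of the pair
`(O, O ∖ K)`) is `(Σ_{z ∈ Z} sign det A z) • g_q`.
[cite: Bredon1993, IV.7 Thm. 7.4 and Cor. 7.5] [cite: HatcherAT2002, Prop. 2.30, §3.3 p. 233] -/
theorem map_classAlong_eq_sum_detSign_smul
    (g : HomologicalOrientation ℤ (EuclideanSpace ℝ (Fin n)) n)
    {O K : Set (EuclideanSpace ℝ (Fin n))} (hO : IsOpen O) (hK : IsCompact K) (hKO : K ⊆ O)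
    (f : EuclideanSpace ℝ (Fin n) → EuclideanSpace ℝ (Fin n)) (hf : ContinuousOn f O)
    (q : EuclideanSpace ℝ (Fin n)) {ι : Type*} [Fintype ι] (v : ι → EuclideanSpace ℝ (Fin n))
    (hv : Injective v) (hZ : ∀ x ∈ O, f x = q ↔ ∃ i, x = v i) (hvK : ∀ i, v i ∈ K)
    (A : ι → (EuclideanSpace ℝ (Fin n) →L[ℝ] EuclideanSpace ℝ (Fin n)))
    (hA : ∀ i, HasFDerivAt f (A i) (v i))
    (hdet : ∀ i, LinearMap.det (A i : EuclideanSpace ℝ (Fin n) →ₗ[ℝ] EuclideanSpace ℝ (Fin n)) ≠ 0)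
    (α : localHomologyOfSet ℤ ℤ (EuclideanSpace ℝ (Fin n)) K n)
    (hα : ∀ i, restrictToPoint ℤ ℤ (hvK i) n α = g.localClass (v i))
    (hmaps : MapsTo (fun x : ↥O => f x) (Subtype.val ⁻¹' K)ᶜ ({q}ᶜ : Set (EuclideanSpace ℝ (Fin n)))) :
    relativeSingularHomology.map ℤ ℤ (⟨fun x : ↥O => f x, hf.restrict⟩ : C(↥O, EuclideanSpace ℝ (Fin n)))
        hmaps n ((localHomologyOfSet.openSubsetIso ℤ ℤ hO (by rwa [hK.isClosed.closure_eq]) n).inv α) =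
      (∑ i, (if 0 < LinearMap.det (A i : EuclideanSpace ℝ (Fin n) →ₗ[ℝ] EuclideanSpace ℝ (Fin n))
        then (1 : ℤ) else -1)) • g.localClass q := by
  classical
  have hclK : closure K ⊆ O := by rwa [hK.isClosed.closure_eq]
  let f₀ : C(↥O, EuclideanSpace ℝ (Fin n)) := ⟨fun x => f x, hf.restrict⟩
  set K' : Set ↥O := Subtype.val ⁻¹' K with hK'
  set αO : localHomologyOfSet ℤ ℤ (↥O) K' n :=
    (localHomologyOfSet.openSubsetIso ℤ ℤ hO hclK n).inv α with hαO
  -- localise at the fibre `S = {v i}`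
  set S : Set (EuclideanSpace ℝ (Fin n)) := Set.range v with hS
  have hSK : S ⊆ K := by
    rintro _ ⟨i, rfl⟩
    exact hvK i
  set S' : Set ↥O := Subtype.val ⁻¹' S with hS'
  have hS'K' : S' ⊆ K' := preimage_mono hSK
  have hf₀S : MapsTo f₀ S'ᶜ ({q}ᶜ : Set (EuclideanSpace ℝ (Fin n))) := by
    intro x hx h0
    obtain ⟨i, hi⟩ := (hZ x x.2).1 h0
    exact hx ⟨i, hi.symm⟩
  have hfacS : relativeSingularHomology.map ℤ ℤ f₀ hf₀S n (restrictLocal ℤ ℤ hS'K' n αO) =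
      relativeSingularHomology.map ℤ ℤ f₀ hmaps n αO := by
    rw [restrictLocal, ← ModuleCat.comp_apply, ← relativeSingularHomology.map_comp]
    rfl
  -- the restricted class is the excision of `α` restricted to `S`
  have hSO : S ⊆ O := hSK.trans hKO
  have hSfin : S.Finite := Set.finite_range v
  have hclS : closure S ⊆ O := by rwa [hSfin.isClosed.closure_eq]
  set αS : localHomologyOfSet ℤ ℤ (EuclideanSpace ℝ (Fin n)) S n := restrictLocal ℤ ℤ hSK n α with hαS
  have hαS' : restrictLocal ℤ ℤ hS'K' n αO =
      (localHomologyOfSet.openSubsetIso ℤ ℤ hO hclS n).inv αS := by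
    apply (localHomologyOfSet.openSubsetIso ℤ ℤ hO hclS n).toLinearEquiv.injective
    change (localHomologyOfSet.openSubsetIso ℤ ℤ hO hclS n).hom _ =
      (localHomologyOfSet.openSubsetIso ℤ ℤ hO hclS n).hom _
    rw [← ModuleCat.comp_apply (localHomologyOfSet.openSubsetIso ℤ ℤ hO hclS n).inv,
      Iso.inv_hom_id, ModuleCat.id_apply, hαS, hαO]
    have hnat : restrictLocal ℤ ℤ hS'K' n ≫ (localHomologyOfSet.openSubsetIso ℤ ℤ hO hclS n).hom =
        (localHomologyOfSet.openSubsetIso ℤ ℤ hO hclK n).hom ≫ restrictLocal ℤ ℤ hSK n := by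
      change relativeSingularHomology.map ℤ ℤ _ _ n ≫ relativeSingularHomology.map ℤ ℤ _ _ n =
        relativeSingularHomology.map ℤ ℤ _ _ n ≫ relativeSingularHomology.map ℤ ℤ _ _ n
      rw [← relativeSingularHomology.map_comp, ← relativeSingularHomology.map_comp]
      rfl
    rw [← ModuleCat.comp_apply, hnat, ModuleCat.comp_apply, ← ModuleCat.comp_apply _
      (localHomologyOfSet.openSubsetIso ℤ ℤ hO hclK n).hom, Iso.inv_hom_id, ModuleCat.id_apply]
  -- separate the points of the fibre by balls
  obtain ⟨ρ, hρ, hballO, hsep⟩ := exists_radius_balls hO (Finset.univ.image v)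
    (by
      intro z hz
      obtain ⟨i, -, rfl⟩ := Finset.mem_image.1 (Finset.mem_coe.1 hz)
      exact hSO ⟨i, rfl⟩)
  have hvZ : ∀ i, v i ∈ Finset.univ.image v := fun i => Finset.mem_image_of_mem v (Finset.mem_univ i)
  let U : ι → Set (EuclideanSpace ℝ (Fin n)) := fun i => ball (v i) ρ
  have hvU : ∀ i, v i ∈ U i := fun i => mem_ball_self hρ
  have hsepU : ∀ i l, l ≠ i → v l ∉ U i := fun i l hli =>
    hsep (v i) (hvZ i) (v l) (hvZ l) (hv.ne hli)
  have hSU : S = ⋃ i ∈ (Finset.univ : Finset ι), ({v i} : Set (EuclideanSpace ℝ (Fin n))) := by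
    ext x
    simp only [hS, mem_range, mem_iUnion, mem_singleton_iff, Finset.mem_univ, exists_true_left]
    exact ⟨fun ⟨i, hi⟩ => ⟨i, hi.symm⟩, fun ⟨i, hi⟩ => ⟨i, hi.symm⟩⟩
  -- the local classes on the balls
  let w : ∀ i, relativeSingularHomology ℤ ℤ ↥(U i) {(⟨v i, hvU i⟩ : ↥(U i))}ᶜ n := fun i =>
    (localHomology.openSubsetIso ℤ ℤ (isOpen_ball) (hvU i) n).inv (g.localClass (v i))
  have hw : ∀ i, relativeSingularHomology.map ℤ ℤ (subsetIncl (U i))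
      (localHomology.mapsTo_subsetIncl_compl (hvU i)) n (w i) =
      restrictLocal ℤ ℤ (localHomologyOfSet.singleton_subset_of_eq_biUnion_singleton hSU i) n αS := by
    intro i
    have h1 : relativeSingularHomology.map ℤ ℤ (subsetIncl (U i))
        (localHomology.mapsTo_subsetIncl_compl (hvU i)) n (w i) = g.localClass (v i) := by
      change (localHomology.openSubsetIso ℤ ℤ (isOpen_ball) (hvU i) n).hom
        ((localHomology.openSubsetIso ℤ ℤ (isOpen_ball) (hvU i) n).inv _) = _
      rw [← ModuleCat.comp_apply, Iso.inv_hom_id, ModuleCat.id_apply]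
    rw [h1, hαS, ← ModuleCat.comp_apply, restrictLocal_comp]
    exact (hα i).symm
  have hsum := localHomologyOfSet.eq_sum_of_forall_map_eq_restrictLocal ℤ ℤ hv hvU hsepU hSU n αS w hw
  -- push the sum forward: each term is a local degree
  set e := localHomologyOfSet.openSubsetIso ℤ ℤ hO hclS n with he
  have hUO : ∀ i, U i ⊆ O := fun i => hballO (v i) (hvZ i)
  let j : ∀ i, C(↥(U i), ↥O) := fun i => subsetInclusion (hUO i)
  have hj : ∀ i, MapsTo (j i) ({(⟨v i, hvU i⟩ : ↥(U i))}ᶜ : Set ↥(U i)) S'ᶜ := by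
    intro i y hy hyS
    have := localHomologyOfSet.mapsTo_subsetIncl_compl_of_forall_notMem hSU hvU hsepU i hy
    exact this hyS
  have hterm : ∀ i, relativeSingularHomology.map ℤ ℤ (subsetIncl (U i))
      (localHomologyOfSet.mapsTo_subsetIncl_compl_of_forall_notMem hSU hvU hsepU i) n ≫ e.inv =
      relativeSingularHomology.map ℤ ℤ (j i) (hj i) n := by
    intro i
    rw [Iso.comp_inv_eq, he]
    change _ = _ ≫ relativeSingularHomology.map ℤ ℤ (subsetIncl O) _ n
    rw [← relativeSingularHomology.map_comp]
    rfl
  have hinvS : e.inv αS = ∑ i, relativeSingularHomology.map ℤ ℤ (j i) (hj i) n (w i) := by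
    rw [hsum, map_sum]
    refine Finset.sum_congr rfl fun i _ => ?_
    rw [← ModuleCat.comp_apply, hterm]
  -- the local degree at each point of the fibre
  have hdeg : ∀ i, relativeSingularHomology.map ℤ ℤ f₀ hf₀S n
      (relativeSingularHomology.map ℤ ℤ (j i) (hj i) n (w i)) =
      if 0 < LinearMap.det (A i : EuclideanSpace ℝ (Fin n) →ₗ[ℝ] EuclideanSpace ℝ (Fin n))
      then g.localClass q else -g.localClass q := by
    intro i
    have hmapsU : MapsTo (fun y : ↥(U i) => f y) {(⟨v i, hvU i⟩ : ↥(U i))}ᶜ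
        ({q}ᶜ : Set (EuclideanSpace ℝ (Fin n))) := by
      intro y hy h0
      obtain ⟨l, hl⟩ := (hZ _ (hUO i y.2)).1 h0
      exact hj i hy ⟨l, hl.symm⟩
    have hloc := HomologicalOrientation.localDegree_of_hasFDerivAt g f (isOpen_ball) (hvU i)
      (hf.mono (hUO i)) (hA i) (hdet i) ((hZ _ (hKO (hvK i))).2 ⟨i, rfl⟩) hmapsU
    have key : relativeSingularHomology.map ℤ ℤ f₀ hf₀S n
        (relativeSingularHomology.map ℤ ℤ (j i) (hj i) n (w i)) =
        relativeSingularHomology.map ℤ ℤ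
          (⟨fun y : ↥(U i) => f y, (hf.mono (hUO i)).restrict⟩ : C(↥(U i), EuclideanSpace ℝ (Fin n)))
          hmapsU n (w i) := by
      rw [← ModuleCat.comp_apply, ← relativeSingularHomology.map_comp]
      rfl
    rw [key]
    exact hloc
  -- assemble
  change relativeSingularHomology.map ℤ ℤ f₀ hmaps n αO = _
  rw [← hfacS, hαS', hinvS, map_sum]
  simp_rw [hdeg]
  rw [sum_zsmul_eq]
  refine Finset.sum_congr rfl fun i _ => ?_
  split_ifs <;> simp

/-- **Two maps agreeing off `K` push the class along `K` to the same element**: if `f₀ = f₁` on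
`O ∖ K` and `f₀ ≠ q` there, the straight-line homotopy `(1 - s) f₀ + s f₁` is a homotopy of maps of
pairs `(O, O ∖ K) → (ℝⁿ, ℝⁿ ∖ q)` (Hatcher 2002, Prop. 2.19 for pairs, the tree's
`relativeSingularHomology.map_eq_of_homotopic_holds`). [cite: HatcherAT2002, Prop. 2.19, Thm. 2.20] -/
theorem map_classAlong_eq_of_eqOn {O K : Set (EuclideanSpace ℝ (Fin n))}
    (f₀ f₁ : EuclideanSpace ℝ (Fin n) → EuclideanSpace ℝ (Fin n)) (hf₀ : ContinuousOn f₀ O)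
    (hf₁ : ContinuousOn f₁ O) (heq : ∀ x ∈ O, x ∉ K → f₁ x = f₀ x) (q : EuclideanSpace ℝ (Fin n))
    (h₀ : MapsTo (fun x : ↥O => f₀ x) (Subtype.val ⁻¹' K)ᶜ ({q}ᶜ : Set (EuclideanSpace ℝ (Fin n))))
    (h₁ : MapsTo (fun x : ↥O => f₁ x) (Subtype.val ⁻¹' K)ᶜ ({q}ᶜ : Set (EuclideanSpace ℝ (Fin n))))
    (k : ℕ) :
    relativeSingularHomology.map ℤ ℤ (⟨fun x : ↥O => f₀ x, hf₀.restrict⟩ : C(↥O, EuclideanSpace ℝ (Fin n))) h₀ k =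
      relativeSingularHomology.map ℤ ℤ (⟨fun x : ↥O => f₁ x, hf₁.restrict⟩ : C(↥O, EuclideanSpace ℝ (Fin n))) h₁ k := by
  let g₀ : C(↥O, EuclideanSpace ℝ (Fin n)) := ⟨fun x => f₀ x, hf₀.restrict⟩
  let g₁ : C(↥O, EuclideanSpace ℝ (Fin n)) := ⟨fun x => f₁ x, hf₁.restrict⟩
  let H : ContinuousMap.Homotopy g₀ g₁ :=
    { toFun := fun p => f₀ p.2 + (p.1 : ℝ) • (f₁ p.2 - f₀ p.2)
      continuous_toFun := by
        have h0 : Continuous fun p : I × ↥O => f₀ p.2 := g₀.continuous.comp continuous_snd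
        have h1 : Continuous fun p : I × ↥O => f₁ p.2 := g₁.continuous.comp continuous_snd
        exact h0.add ((continuous_subtype_val.comp continuous_fst).smul (h1.sub h0))
      map_zero_left := fun x => by simp [g₀]
      map_one_left := fun x => by simp [g₁] }
  have hH : ∀ tx : I × ↥O, tx.2 ∈ (Subtype.val ⁻¹' K)ᶜ → H tx ∈ ({q}ᶜ : Set (EuclideanSpace ℝ (Fin n))) := by
    intro tx hx
    have e : H tx = f₀ tx.2 := by
      change f₀ tx.2 + (tx.1 : ℝ) • (f₁ tx.2 - f₀ tx.2) = f₀ tx.2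
      rw [heq _ tx.2.2 hx, sub_self, smul_zero, add_zero]
    rw [e]
    exact h₀ hx
  exact relativeSingularHomology.map_eq_of_homotopic_holds ℤ ℤ h₀ h₁ H hH k

/-- **The point class pushes forward like the class along `K ∋ p`**: for `p ∈ K ⊆ O ⊆ V`
(`K` compact, `O`, `V` open), `t` continuous on `V` with `t ≠ q` on `V ∖ p`, and `α ∈ Hₙ(ℝⁿ | K)`
restricting to `g_p` at `p`, the push-forward of the excised point class `g_p ∈ Hₙ(V | p)` along
`t : (V, V ∖ p) → (ℝⁿ, ℝⁿ ∖ q)` equals the push-forward of the excised `α` along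
`t : (O, O ∖ K) → (ℝⁿ, ℝⁿ ∖ q)` (excision `Hₙ(O | p) ≅ Hₙ(V | p)` and naturality; Hatcher 2002,
Thm. 2.20, §3.3 p. 233). [cite: HatcherAT2002, Thm. 2.20, §3.3 p. 233] -/
theorem map_openSubsetIso_inv_localClass_eq_map_classAlong
    (g : HomologicalOrientation ℤ (EuclideanSpace ℝ (Fin n)) n)
    {V O K : Set (EuclideanSpace ℝ (Fin n))} (hV : IsOpen V) (hO : IsOpen O) (hK : IsCompact K)
    (hOV : O ⊆ V) (hKO : K ⊆ O) {p : EuclideanSpace ℝ (Fin n)} (hpK : p ∈ K)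
    (t : EuclideanSpace ℝ (Fin n) → EuclideanSpace ℝ (Fin n)) (htc : ContinuousOn t V)
    (q : EuclideanSpace ℝ (Fin n))
    (h : MapsTo (fun v : ↥V => t v) {(⟨p, hOV (hKO hpK)⟩ : ↥V)}ᶜ ({q}ᶜ : Set (EuclideanSpace ℝ (Fin n))))
    (hO' : MapsTo (fun x : ↥O => t x) (Subtype.val ⁻¹' K)ᶜ ({q}ᶜ : Set (EuclideanSpace ℝ (Fin n))))
    (α : localHomologyOfSet ℤ ℤ (EuclideanSpace ℝ (Fin n)) K n)
    (hα : restrictToPoint ℤ ℤ hpK n α = g.localClass p) :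
    relativeSingularHomology.map ℤ ℤ (⟨fun v : ↥V => t v, htc.restrict⟩ : C(↥V, EuclideanSpace ℝ (Fin n))) h n
        ((localHomology.openSubsetIso ℤ ℤ hV (hOV (hKO hpK)) n).inv (g.localClass p)) =
      relativeSingularHomology.map ℤ ℤ (⟨fun x : ↥O => t x, (htc.mono hOV).restrict⟩ : C(↥O, EuclideanSpace ℝ (Fin n)))
        hO' n ((localHomologyOfSet.openSubsetIso ℤ ℤ hO (by rwa [hK.isClosed.closure_eq]) n).inv α) := by
  have hclK : closure K ⊆ O := by rwa [hK.isClosed.closure_eq]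
  have hpO : p ∈ O := hKO hpK
  have hpV : p ∈ V := hOV hpO
  set K' : Set ↥O := Subtype.val ⁻¹' K with hK'
  set αO := (localHomologyOfSet.openSubsetIso ℤ ℤ hO hclK n).inv α with hαO
  -- (1) on `O`: factor through the restriction to the point `p`
  have hpK' : (⟨p, hpO⟩ : ↥O) ∈ K' := hpK
  have hOp : MapsTo (fun x : ↥O => t x) ({(⟨p, hpO⟩ : ↥O)}ᶜ : Set ↥O) ({q}ᶜ : Set (EuclideanSpace ℝ (Fin n))) := by
    intro x hx
    refine h (x := ⟨x, hOV x.2⟩) fun hx' => hx ?_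
    rw [mem_singleton_iff] at hx' ⊢
    have hxp : (x : EuclideanSpace ℝ (Fin n)) = p := congrArg Subtype.val hx'
    exact Subtype.ext hxp
  have e1 : relativeSingularHomology.map ℤ ℤ (⟨fun x : ↥O => t x, (htc.mono hOV).restrict⟩ : C(↥O, _)) hOp n
        (restrictToPoint ℤ ℤ hpK' n αO) =
      relativeSingularHomology.map ℤ ℤ (⟨fun x : ↥O => t x, (htc.mono hOV).restrict⟩ : C(↥O, _)) hO' n αO := by
    rw [restrictToPoint, restrictLocal, ← ModuleCat.comp_apply, ← relativeSingularHomology.map_comp]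
    rfl
  -- (2) the restriction of `αO` to `p` is the excised point class
  have e2 : restrictToPoint ℤ ℤ hpK' n αO = (localHomology.openSubsetIso ℤ ℤ hO hpO n).inv (g.localClass p) := by
    apply (localHomology.openSubsetIso ℤ ℤ hO hpO n).toLinearEquiv.injective
    change (localHomology.openSubsetIso ℤ ℤ hO hpO n).hom _ = (localHomology.openSubsetIso ℤ ℤ hO hpO n).hom _
    rw [← ModuleCat.comp_apply (localHomology.openSubsetIso ℤ ℤ hO hpO n).inv, Iso.inv_hom_id,
      ModuleCat.id_apply, ← hα, hαO]
    have hnat : restrictToPoint ℤ ℤ hpK' n ≫ (localHomology.openSubsetIso ℤ ℤ hO hpO n).hom =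
        (localHomologyOfSet.openSubsetIso ℤ ℤ hO hclK n).hom ≫ restrictToPoint ℤ ℤ hpK n := by
      change relativeSingularHomology.map ℤ ℤ _ _ n ≫ relativeSingularHomology.map ℤ ℤ _ _ n =
        relativeSingularHomology.map ℤ ℤ _ _ n ≫ relativeSingularHomology.map ℤ ℤ _ _ n
      rw [← relativeSingularHomology.map_comp, ← relativeSingularHomology.map_comp]
      rfl
    rw [← ModuleCat.comp_apply, hnat, ModuleCat.comp_apply, ← ModuleCat.comp_apply _
      (localHomologyOfSet.openSubsetIso ℤ ℤ hO hclK n).hom, Iso.inv_hom_id, ModuleCat.id_apply]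
  -- (3) from `O` to `V` by the inclusion `(O, O ∖ p) → (V, V ∖ p)`
  let incl : C(↥O, ↥V) := subsetInclusion hOV
  have hincl : MapsTo incl ({(⟨p, hpO⟩ : ↥O)}ᶜ : Set ↥O) ({(⟨p, hpV⟩ : ↥V)}ᶜ : Set ↥V) := by
    intro x hx hx'
    apply hx
    rw [mem_singleton_iff] at hx' ⊢
    have hxp : (x : EuclideanSpace ℝ (Fin n)) = p := congrArg Subtype.val hx'
    exact Subtype.ext hxp
  have hfac : (localHomology.openSubsetIso ℤ ℤ hO hpO n).hom =
      relativeSingularHomology.map ℤ ℤ incl hincl n ≫ (localHomology.openSubsetIso ℤ ℤ hV hpV n).hom := by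
    change relativeSingularHomology.map ℤ ℤ (subsetIncl O) _ n =
      relativeSingularHomology.map ℤ ℤ incl hincl n ≫ relativeSingularHomology.map ℤ ℤ (subsetIncl V) _ n
    rw [← relativeSingularHomology.map_comp]
    rfl
  have e3 : (localHomology.openSubsetIso ℤ ℤ hV hpV n).inv (g.localClass p) =
      relativeSingularHomology.map ℤ ℤ incl hincl n ((localHomology.openSubsetIso ℤ ℤ hO hpO n).inv (g.localClass p)) := by
    have h1 : (localHomology.openSubsetIso ℤ ℤ hO hpO n).hom
        ((localHomology.openSubsetIso ℤ ℤ hO hpO n).inv (g.localClass p)) = g.localClass p := by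
      rw [← ModuleCat.comp_apply, Iso.inv_hom_id, ModuleCat.id_apply]
    conv_lhs => rw [← h1, hfac, ModuleCat.comp_apply]
    rw [← ModuleCat.comp_apply _ (localHomology.openSubsetIso ℤ ℤ hV hpV n).inv, Iso.hom_inv_id,
      ModuleCat.id_apply]
  have e4 : relativeSingularHomology.map ℤ ℤ incl hincl n ≫
      relativeSingularHomology.map ℤ ℤ (⟨fun v : ↥V => t v, htc.restrict⟩ : C(↥V, _)) h n =
      relativeSingularHomology.map ℤ ℤ (⟨fun x : ↥O => t x, (htc.mono hOV).restrict⟩ : C(↥O, _)) hOp n := by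
    rw [← relativeSingularHomology.map_comp]
    rfl
  rw [e3, ← ModuleCat.comp_apply, e4]
  change _ = relativeSingularHomology.map ℤ ℤ _ hO' n αO
  rw [← e1, e2]

end ClassAlong

/-! ### Plane models: products of linear factors, their winding numbers and derivatives -/

section PlaneModels

/-- The loop `s ↦ circleLoop c r s - a` about a point `a` of the open disc is a loop in
`ℂ \ {0}`. [folklore] -/
theorem isNonvanishingLoop_circleLoop_sub {c a : ℂ} {r : ℝ} (ha : ‖a - c‖ < r) :
    IsNonvanishingLoop fun s => circleLoop c r s - a := by
  have hr : 0 < r := (norm_nonneg _).trans_lt ha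
  refine ⟨(continuous_circleLoop c r).continuousOn.sub continuousOn_const, fun s _ h0 => ?_,
    by rw [circleLoop_zero_eq]⟩
  have h1 : circleLoop c r s = a := sub_eq_zero.1 h0
  have := norm_circleLoop_sub_center c r s
  rw [h1, abs_of_pos hr] at this
  exact ha.ne this

/-- **The product loop `∏ⱼ (circle - aⱼ)` winds `N` times** for `N` points `aⱼ` inside the circle
(`wind_finset_prod`, `wind_circleLoop_sub_of_norm_lt`). [folklore] -/
theorem wind_prod_circleLoop_sub {N : ℕ} {c : ℂ} {r : ℝ} (a : Fin N → ℂ)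
    (ha : ∀ j, ‖a j - c‖ < r) :
    IsNonvanishingLoop (fun s => ∏ j, (circleLoop c r s - a j)) ∧
      wind (fun s => ∏ j, (circleLoop c r s - a j)) = N := by
  obtain ⟨h1, h2⟩ := Literature.Analysis.Complex.ArgPrinciple.wind_finset_prod Finset.univ (fun j s => circleLoop c r s - a j)
    fun j _ => isNonvanishingLoop_circleLoop_sub (ha j)
  refine ⟨h1, ?_⟩
  rw [h2, Finset.sum_congr rfl fun j _ => wind_circleLoop_sub_of_norm_lt (ha j)]
  simp

/-- The real determinant of `z ↦ c z` (`c ∈ ℂ`) is `|c|²`. [folklore] -/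
theorem det_smul_one_eq_normSq (c : ℂ) :
    LinearMap.det ((c • (1 : ℂ →L[ℝ] ℂ) : ℂ →L[ℝ] ℂ) : ℂ →ₗ[ℝ] ℂ) = normSq c := by
  have e : ((c • (1 : ℂ →L[ℝ] ℂ) : ℂ →L[ℝ] ℂ) : ℂ →ₗ[ℝ] ℂ) =
      (c • LinearMap.id : ℂ →ₗ[ℂ] ℂ).restrictScalars ℝ := by
    ext z; simp
  rw [e, Literature.Topology.FourManifolds.det_restrictScalars_eq_normSq, LinearMap.det_smul,
    LinearMap.det_id, Module.finrank_self]
  simp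

/-- The real determinant of `c • ψ` for a real-linear `ψ : ℂ → ℂ` is `|c|² det ψ`. [folklore] -/
theorem det_smul_eq_normSq_mul (c : ℂ) (ψ : ℂ →L[ℝ] ℂ) :
    LinearMap.det ((c • ψ : ℂ →L[ℝ] ℂ) : ℂ →ₗ[ℝ] ℂ) =
      normSq c * LinearMap.det (ψ : ℂ →ₗ[ℝ] ℂ) := by
  have e : ((c • ψ : ℂ →L[ℝ] ℂ) : ℂ →ₗ[ℝ] ℂ) =
      ((c • (1 : ℂ →L[ℝ] ℂ) : ℂ →L[ℝ] ℂ) : ℂ →ₗ[ℝ] ℂ) ∘ₗ (ψ : ℂ →ₗ[ℝ] ℂ) := by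
    ext z; simp
  rw [e, LinearMap.det_comp, det_smul_one_eq_normSq]

/-- The real determinant of complex conjugation is `-1`. [folklore] -/
theorem det_conjCLE : LinearMap.det ((conjCLE : ℂ →L[ℝ] ℂ) : ℂ →ₗ[ℝ] ℂ) = -1 := by
  have e : ((conjCLE : ℂ →L[ℝ] ℂ) : ℂ →ₗ[ℝ] ℂ) = conjAe.toLinearMap := by
    ext z; simp
  rw [e]
  exact det_conjAe

/-- **The factor map of sign `±`**: for an integer `w` let `ψ` be the identity if `0 ≤ w` and complex
conjugation if `w < 0`.  Then `ψ` is a real-linear automorphism of `ℂ` with `ψ z = 0 ↔ z = 0`,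
`sign det ψ = sign w` (for `w ≠ 0`), and `ψ` multiplies winding numbers by that sign. [folklore] -/
theorem exists_signFactor (w : ℤ) :
    ∃ ψ : ℂ →L[ℝ] ℂ, (∀ z, ψ z = 0 ↔ z = 0) ∧ (∀ z, ‖ψ z‖ = ‖z‖) ∧
      LinearMap.det (ψ : ℂ →ₗ[ℝ] ℂ) ≠ 0 ∧
      (w.natAbs : ℤ) * (if 0 < LinearMap.det (ψ : ℂ →ₗ[ℝ] ℂ) then 1 else -1) = w ∧
      ∀ f : ℝ → ℂ, IsNonvanishingLoop f →
        IsNonvanishingLoop (fun s => ψ (f s)) ∧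
        wind (fun s => ψ (f s)) = (if 0 < LinearMap.det (ψ : ℂ →ₗ[ℝ] ℂ) then 1 else -1) * wind f := by
  rcases le_or_gt 0 w with hw | hw
  · refine ⟨1, fun z => by simp, fun z => by simp, ?_, ?_, fun f hf => ?_⟩
    · simp
    · simp [Int.natAbs_of_nonneg hw]
    · simpa using hf
  · have hdet : LinearMap.det ((conjCLE : ℂ →L[ℝ] ℂ) : ℂ →ₗ[ℝ] ℂ) = -1 := det_conjCLE
    refine ⟨conjCLE, fun z => by simp, fun z => by simp, ?_, ?_, fun f hf => ?_⟩
    · rw [hdet]; norm_num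
    · rw [hdet, if_neg (by norm_num)]
      have := Int.natAbs_of_nonneg (neg_nonneg.2 hw.le)
      omega
    · rw [hdet, if_neg (by norm_num)]
      refine ⟨?_, ?_⟩
      · exact ⟨continuous_conj.comp_continuousOn hf.continuousOn,
          fun s hs => by simpa using hf.ne_zero s hs, by simp [hf.eq_endpoints]⟩
      · simpa using wind_conj hf

end PlaneModels

/-! ### Radial extension of a function on an annulus to the disc -/

section RadialExtension

/-- **Radial extension.**  A function `L` continuous on the closed annulus `r ≤ ‖z - c‖ ≤ R`
(`0 < r ≤ R`) agrees on `r ≤ ‖z - c‖ < R` with a function `L'` continuous on the open disc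
`‖z - c‖ < R` and CONSTANT (equal to `L (c + r)`) on the disc `‖z - c‖ ≤ r / 2`: interpolate
radially between `L` on the circle of radius `r` and the constant. [folklore] -/
theorem exists_radialExtension {c : ℂ} {r R : ℝ} (hr : 0 < r) (hrR : r ≤ R) {L : ℂ → ℂ}
    (hL : ContinuousOn L {z : ℂ | r ≤ ‖z - c‖ ∧ ‖z - c‖ ≤ R}) :
    ∃ L' : ℂ → ℂ, ContinuousOn L' (ball c R) ∧
      (∀ z, r ≤ ‖z - c‖ → ‖z - c‖ ≤ R → L' z = L z) ∧
      (∀ z, ‖z - c‖ ≤ r / 2 → L' z = L (c + r)) := by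
  set A : Set ℂ := {z : ℂ | r ≤ ‖z - c‖ ∧ ‖z - c‖ ≤ R} with hA
  -- the cut-off `χ`: `0` on `[0, r/2]`, `1` on `[r, ∞)`
  set χ : ℝ → ℝ := fun ρ => max 0 (min 1 (2 * ρ / r - 1)) with hχ
  have hχc : Continuous χ := by
    simp only [hχ]
    fun_prop
  have hχ1 : ∀ ρ, r ≤ ρ → χ ρ = 1 := by
    intro ρ hρ
    have h1 : 1 ≤ 2 * ρ / r - 1 := by
      rw [le_sub_iff_add_le, le_div_iff₀ hr]; linarith
    simp only [hχ]
    rw [min_eq_left h1, max_eq_right zero_le_one]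
  have hχ0 : ∀ ρ, ρ ≤ r / 2 → χ ρ = 0 := by
    intro ρ hρ
    have h1 : 2 * ρ / r - 1 ≤ 0 := by
      rw [sub_nonpos, div_le_one hr]; linarith
    simp only [hχ]
    exact max_eq_left ((min_le_right _ _).trans h1)
  -- the radial retraction onto the annulus (off the centre)
  set ret : ℂ → ℂ := fun z => c + ((max r ‖z - c‖ / ‖z - c‖ : ℝ) : ℂ) * (z - c) with hret
  have hret_norm : ∀ z, z ≠ c → ‖ret z - c‖ = max r ‖z - c‖ := by
    intro z hz
    have hp : 0 < ‖z - c‖ := norm_pos_iff.2 (sub_ne_zero.2 hz)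
    simp only [hret]
    rw [add_sub_cancel_left, norm_mul, Complex.norm_of_nonneg
      (div_nonneg (hr.le.trans (le_max_left _ _)) hp.le), div_mul_cancel₀ _ hp.ne']
  have hret_id : ∀ z, r ≤ ‖z - c‖ → ret z = z := by
    intro z hz
    have hp : 0 < ‖z - c‖ := hr.trans_le hz
    simp only [hret]
    rw [max_eq_right hz, div_self hp.ne', ofReal_one, one_mul, add_sub_cancel]
  set L' : ℂ → ℂ := fun z => (χ ‖z - c‖ : ℂ) * L (ret z) + (1 - (χ ‖z - c‖ : ℂ)) * L (c + r)
    with hL'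
  have hL'B : ∀ z, ‖z - c‖ ≤ r / 2 → L' z = L (c + r) := by
    intro z hz
    simp only [hL']
    rw [hχ0 _ hz]
    push_cast
    ring
  refine ⟨L', ?_, fun z hz _ => ?_, hL'B⟩
  · -- continuity on the open disc
    set W : Set ℂ := {z : ℂ | r / 4 < ‖z - c‖ ∧ ‖z - c‖ < R} with hW
    have hWo : IsOpen W :=
      (isOpen_lt continuous_const (continuous_norm.comp (continuous_id.sub continuous_const))).inter
        (isOpen_lt (continuous_norm.comp (continuous_id.sub continuous_const)) continuous_const)
    have hWne : ∀ z ∈ W, ‖z - c‖ ≠ 0 := fun z hz => ((by positivity : (0 : ℝ) < r / 4).trans hz.1).ne'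
    have hretc : ContinuousOn ret W := by
      simp only [hret]
      have hm : Continuous fun z : ℂ => max r ‖z - c‖ :=
        continuous_const.max (continuous_norm.comp (continuous_id.sub continuous_const))
      exact continuousOn_const.add ((continuous_ofReal.comp_continuousOn
        (hm.continuousOn.div
          (continuous_norm.comp_continuousOn (continuousOn_id.sub continuousOn_const)) hWne)).mul
        (continuousOn_id.sub continuousOn_const))
    have hmaps : MapsTo ret W A := by
      intro z hz
      have hzc : z ≠ c := fun h => hWne z hz (by rw [h, sub_self, norm_zero])
      refine ⟨?_, ?_⟩
      · rw [hret_norm z hzc]; exact le_max_left _ _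
      · rw [hret_norm z hzc]; exact max_le hrR hz.2.le
    have h1 : Continuous fun z : ℂ => (χ ‖z - c‖ : ℂ) :=
      continuous_ofReal.comp (hχc.comp (continuous_norm.comp (continuous_id.sub continuous_const)))
    have hW' : ContinuousOn L' W := by
      simp only [hL']
      exact (h1.continuousOn.mul (hL.comp hretc hmaps)).add
        ((continuousOn_const.sub h1.continuousOn).mul continuousOn_const)
    have hB : ContinuousOn L' (ball c (r / 2)) :=
      continuousOn_const.congr fun z hz => hL'B z (mem_ball_iff_norm.1 hz).le
    intro z hz
    rcases lt_or_ge ‖z - c‖ (r / 2) with h | h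
    · exact (hB.continuousAt (isOpen_ball.mem_nhds (mem_ball_iff_norm.2 h))).continuousWithinAt
    · have hzW : z ∈ W := ⟨by linarith, mem_ball_iff_norm.1 hz⟩
      exact (hW'.continuousAt (hWo.mem_nhds hzW)).continuousWithinAt
  · simp only [hL']
    rw [hχ1 _ hz, hret_id z hz]
    push_cast
    ring

end RadialExtension

/-! ### The model map with non-degenerate preimages -/

section Model

/-- **The model of a plane map near an isolated preimage** (Bredon 1993, IV.7, Example after
Cor. 7.5, run backwards).  Let `t` be continuous on the closed annulus `r ≤ ‖z - c‖ ≤ R`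
(`0 < r < R`) with `t ≠ q` there, and let `w` be the winding number of `t - q` on the inner circle.
Then there are `N = |w|` distinct points `aⱼ` with `‖aⱼ - c‖ < r/2` and a map `M`, continuous on
the open disc `‖z - c‖ < R`, EQUAL TO `t` on `r ≤ ‖z - c‖ < R`, whose preimages of `q` in the disc
are exactly the `aⱼ`, at each of which `M` is differentiable with invertible derivative `Aⱼ`, and
`Σⱼ sign det Aⱼ = w`.  (`M = q + ∏ⱼ ψ(z - aⱼ) · exp L̃` with `ψ = id` or `conj` according to the
sign of `w`, `L̃` the radial extension of a logarithm of `(t - q)/∏ⱼ ψ(z - aⱼ)` on the annulus,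
which exists because that quotient does not wind, `hasLogOn_annulus_of_wind_eq_zero`.)
[cite: Bredon1993, IV.7 Example following Cor. 7.5 (deg zᵏ = k)] -/
theorem exists_planeModel {t : ℂ → ℂ} {c q : ℂ} {r R : ℝ} (hr : 0 < r) (hrR : r < R)
    (ht : ContinuousOn t {z : ℂ | r ≤ ‖z - c‖ ∧ ‖z - c‖ ≤ R})
    (hne : ∀ z, r ≤ ‖z - c‖ → ‖z - c‖ ≤ R → t z ≠ q) :
    ∃ (N : ℕ) (a : Fin N → ℂ) (M : ℂ → ℂ) (A : Fin N → ℂ →L[ℝ] ℂ),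
      Injective a ∧ (∀ j, ‖a j - c‖ < r / 2) ∧ ContinuousOn M (ball c R) ∧
      (∀ z, r ≤ ‖z - c‖ → ‖z - c‖ < R → M z = t z) ∧
      (∀ z ∈ ball c R, M z = q ↔ ∃ j, z = a j) ∧
      (∀ j, HasFDerivAt M (A j) (a j)) ∧
      (∀ j, LinearMap.det (A j : ℂ →ₗ[ℝ] ℂ) ≠ 0) ∧
      (∑ j, (if 0 < LinearMap.det (A j : ℂ →ₗ[ℝ] ℂ) then (1 : ℤ) else -1)) =
        wind (fun s => t (circleLoop c r s) - q) := by
  set A : Set ℂ := {z : ℂ | r ≤ ‖z - c‖ ∧ ‖z - c‖ ≤ R} with hA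
  set w : ℤ := wind (fun s => t (circleLoop c r s) - q) with hw
  obtain ⟨ψ, hψ0, hψn, hψdet, hψw, hψwind⟩ := exists_signFactor w
  set sgn : ℤ := if 0 < LinearMap.det (ψ : ℂ →ₗ[ℝ] ℂ) then 1 else -1 with hsgn
  set N : ℕ := w.natAbs with hN
  -- the points `aⱼ = c + r (j + 1) / (4 N)` on the real axis through `c`
  set a : Fin N → ℂ := fun j => c + ((r * ((j : ℕ) + 1) / (4 * N) : ℝ) : ℂ) with ha
  have hNpos : ∀ j : Fin N, (0 : ℝ) < N := fun j => by exact_mod_cast Fin.pos j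
  have ha_norm : ∀ j, ‖a j - c‖ = r * ((j : ℕ) + 1) / (4 * N) := by
    intro j
    simp only [ha, add_sub_cancel_left, Complex.norm_real, Real.norm_eq_abs]
    exact abs_of_nonneg (by positivity)
  have ha_lt : ∀ j, ‖a j - c‖ < r / 2 := by
    intro j
    rw [ha_norm j]
    have hj : ((j : ℕ) + 1 : ℝ) ≤ N := by exact_mod_cast j.2
    have hNp := hNpos j
    rw [div_lt_div_iff₀ (by positivity) two_pos]
    nlinarith
  have ha_inj : Injective a := by
    intro i j h
    have h1 : ((r * ((i : ℕ) + 1) / (4 * N) : ℝ) : ℂ) = ((r * ((j : ℕ) + 1) / (4 * N) : ℝ) : ℂ) :=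
      add_left_cancel h
    have h2 : r * ((i : ℕ) + 1) / (4 * N) = r * ((j : ℕ) + 1) / (4 * N) := by exact_mod_cast h1
    have hNp := hNpos j
    have h3 : ((i : ℕ) : ℝ) = (j : ℕ) := by
      field_simp at h2
      nlinarith [h2]
    exact Fin.ext (by exact_mod_cast h3)
  -- the factor model `P z = ∏ⱼ ψ (z - aⱼ)`
  set P : ℂ → ℂ := fun z => ∏ j, ψ (z - a j) with hP
  have hPc : Continuous P :=
    continuous_finsetProd _ fun j _ => ψ.continuous.comp (continuous_id.sub continuous_const)
  have hP0 : ∀ z, P z = 0 ↔ ∃ j, z = a j := by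
    intro z
    simp only [hP, Finset.prod_eq_zero_iff, Finset.mem_univ, true_and, hψ0, sub_eq_zero]
  have hPA : ∀ z, r ≤ ‖z - c‖ → P z ≠ 0 := by
    intro z hz h0
    obtain ⟨j, rfl⟩ := (hP0 z).1 h0
    linarith [ha_lt j]
  -- its loop on the circle of radius `r` winds `w` times
  have hPloop : IsNonvanishingLoop (fun s => P (circleLoop c r s)) ∧
      wind (fun s => P (circleLoop c r s)) = w := by
    have hfac : ∀ j ∈ (Finset.univ : Finset (Fin N)),
        IsNonvanishingLoop fun s => ψ (circleLoop c r s - a j) := fun j _ =>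
      (hψwind _ (isNonvanishingLoop_circleLoop_sub ((ha_lt j).trans (by linarith)))).1
    obtain ⟨h1, h2⟩ := Literature.Analysis.Complex.ArgPrinciple.wind_finset_prod Finset.univ
      (fun j s => ψ (circleLoop c r s - a j)) hfac
    refine ⟨by simpa only [hP] using h1, ?_⟩
    have e : (fun s => P (circleLoop c r s)) = fun s => ∏ j ∈ Finset.univ, ψ (circleLoop c r s - a j) := by
      funext s; simp only [hP]
    rw [e, h2, Finset.sum_congr rfl fun j _ => (hψwind _
      (isNonvanishingLoop_circleLoop_sub ((ha_lt j).trans (by linarith)))).2]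
    simp_rw [wind_circleLoop_sub_of_norm_lt ((ha_lt _).trans (by linarith : r / 2 < r))]
    rw [Finset.sum_const, Finset.card_univ, Fintype.card_fin, mul_one, nsmul_eq_mul]
    exact hψw
  -- the quotient `Q = (t - q) / P` on the annulus does not wind: logarithm `L`
  set Q : ℂ → ℂ := fun z => (t z - q) / P z with hQ
  have hQc : ContinuousOn Q A :=
    (ht.sub continuousOn_const).div hPc.continuousOn fun z hz => hPA z hz.1
  have hQne : ∀ z, r ≤ ‖z - c‖ → ‖z - c‖ ≤ R → Q z ≠ 0 := fun z hz hzR =>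
    div_ne_zero (sub_ne_zero.2 (hne z hz hzR)) (hPA z hz)
  have hcirc : ∀ s, circleLoop c r s ∈ A := fun s => by
    have := norm_circleLoop_sub_center c r s
    rw [abs_of_pos hr] at this
    exact ⟨this.ge, this.le.trans hrR.le⟩
  have htloop : IsNonvanishingLoop fun s => t (circleLoop c r s) - q :=
    ⟨(ht.comp (continuous_circleLoop c r).continuousOn fun s _ => hcirc s).sub continuousOn_const,
      fun s _ => sub_ne_zero.2 (hne _ (hcirc s).1 (hcirc s).2), by rw [circleLoop_zero_eq]⟩
  have hQw : wind (fun s => Q (circleLoop c r s)) = 0 := by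
    change wind (fun s => (t (circleLoop c r s) - q) / P (circleLoop c r s)) = 0
    rw [wind_div htloop hPloop.1, hPloop.2, hw, sub_self]
  obtain ⟨L, hLc, hLe⟩ := hasLogOn_annulus_of_wind_eq_zero hr hQc hQne hQw
  obtain ⟨L', hL'c, hL'A, hL'B⟩ := exists_radialExtension hr hrR.le hLc
  -- the model `M = q + P · exp L'`
  set C : ℂ := exp (L (c + r)) with hC
  set M : ℂ → ℂ := fun z => q + P z * exp (L' z) with hM
  set cj : Fin N → ℂ := fun j => ∏ i ∈ Finset.univ.erase j, ψ (a j - a i) with hcj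
  have hcj0 : ∀ j, cj j ≠ 0 := by
    intro j
    simp only [hcj]
    rw [Finset.prod_ne_zero_iff]
    intro i hi h0
    rw [hψ0, sub_eq_zero] at h0
    exact (Finset.mem_erase.1 hi).1 (ha_inj h0).symm
  refine ⟨N, a, M, fun j => (cj j * C) • ψ, ha_inj, ha_lt, ?_, ?_, ?_, ?_, ?_, ?_⟩
  · -- continuity
    simp only [hM]
    exact continuousOn_const.add (hPc.continuousOn.mul (continuous_exp.comp_continuousOn hL'c))
  · -- agreement with `t` on the annulus
    intro z hz hzR
    simp only [hM]
    rw [hL'A z hz hzR.le, hLe z ⟨hz, hzR.le⟩]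
    simp only [hQ]
    rw [mul_div_cancel₀ _ (hPA z hz), add_sub_cancel]
  · -- the preimages of `q`
    intro z _
    simp only [hM]
    rw [add_eq_left, mul_eq_zero, or_iff_left (exp_ne_zero _)]
    exact hP0 z
  · -- the derivative at `aⱼ`
    intro j
    have hψd : ∀ i (z : ℂ), HasFDerivAt (fun z => ψ (z - a i)) ψ z := by
      intro i z
      have := ψ.hasFDerivAt.comp z ((hasFDerivAt_id z).sub_const (a i))
      rwa [ContinuousLinearMap.comp_id] at this
    have hPd : HasFDerivAt P (cj j • ψ) (a j) := by
      have h := HasFDerivAt.finsetProd (u := (Finset.univ : Finset (Fin N)))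
        (fun i _ => hψd i (a j))
      have e : (∑ i ∈ (Finset.univ : Finset (Fin N)),
          (∏ l ∈ Finset.univ.erase i, ψ (a j - a l)) • ψ) = cj j • ψ := by
        rw [Finset.sum_eq_single j]
        · intro i _ hij
          rw [Finset.prod_eq_zero (i := j) (Finset.mem_erase.2 ⟨Ne.symm hij, Finset.mem_univ j⟩)
            (by rw [sub_self, map_zero]), zero_smul ℂ ψ]
        · intro h; exact absurd (Finset.mem_univ j) h
      rw [e] at h
      simpa only [hP] using h
    have hMd : HasFDerivAt (fun z => q + P z * C) ((cj j * C) • ψ) (a j) := by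
      have := (hPd.mul_const C).const_add q
      rwa [smul_smul, mul_comm C] at this
    refine hMd.congr_of_eventuallyEq ?_
    have hmem : a j ∈ ball c (r / 2) := mem_ball_iff_norm.2 (ha_lt j)
    filter_upwards [isOpen_ball.mem_nhds hmem] with z hz
    simp only [hM, hC]
    rw [hL'B z (mem_ball_iff_norm.1 hz).le]
  · -- invertible derivatives
    intro j
    rw [det_smul_eq_normSq_mul]
    exact mul_ne_zero (by exact_mod_cast (normSq_pos.2 (mul_ne_zero (hcj0 j) (exp_ne_zero _))).ne')
      hψdet
  · -- the sum of the signs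
    have e : ∀ j, (if 0 < LinearMap.det (((cj j * C) • ψ : ℂ →L[ℝ] ℂ) : ℂ →ₗ[ℝ] ℂ) then (1 : ℤ) else -1) = sgn := by
      intro j
      have hiff : 0 < LinearMap.det (((cj j * C) • ψ : ℂ →L[ℝ] ℂ) : ℂ →ₗ[ℝ] ℂ) ↔
          0 < LinearMap.det (ψ : ℂ →ₗ[ℝ] ℂ) := by
        rw [det_smul_eq_normSq_mul]
        exact mul_pos_iff_of_pos_left (normSq_pos.2 (mul_ne_zero (hcj0 j) (exp_ne_zero _)))
      by_cases hpos : 0 < LinearMap.det (ψ : ℂ →ₗ[ℝ] ℂ)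
      · rw [if_pos (hiff.2 hpos), hsgn, if_pos hpos]
      · rw [if_neg (fun h' => hpos (hiff.1 h')), hsgn, if_neg hpos]
    simp_rw [e]
    rw [Finset.sum_const, Finset.card_univ, Fintype.card_fin, nsmul_eq_mul]
    exact hψw

end Model

/-! ### The local degree at an isolated preimage is the winding number -/

section Main

/-- **The local degree of a plane map at an isolated preimage is the winding number** (Bredon
1993, IV.7 Cor. 7.5 and the Example following it; VI.11; Hatcher 2002, Prop. 2.30, §3.3).  Let
`t : ℝ² ⊇ V → ℝ²` be continuous on the open `V ∋ p`, with `t v ≠ q` for `v ∈ V ∖ p` (so `q = t p`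
in every case of interest; otherwise both sides vanish), and let
`ι : ℂ ≃L[ℝ] ℝ²` be any real-linear identification such that the closed disc of radius `r > 0`
about `p` (read in `ℂ`) lies in `V`.  Then pushing the local orientation class `g_p` (excised to `V`)
forward along `t : (V, V ∖ p) → (ℝ², ℝ² ∖ q)` gives `w • g_q`, where `w` is the winding number about
`0` of the loop `s ↦ t(p + r e^{2πis}) - q` read in `ℂ` through `ι`.
[cite: Bredon1993, IV.7 Cor. 7.5 and Example (deg zᵏ = k); VI.11] [cite: HatcherAT2002, Prop. 2.30, §3.3 pp. 233–236] -/
theorem localDegree_eq_wind_smul_localClass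
    (g : HomologicalOrientation ℤ (EuclideanSpace ℝ (Fin 2)) 2) (ι : ℂ ≃L[ℝ] EuclideanSpace ℝ (Fin 2))
    (t : EuclideanSpace ℝ (Fin 2) → EuclideanSpace ℝ (Fin 2)) {V : Set (EuclideanSpace ℝ (Fin 2))}
    (hV : IsOpen V) {p : EuclideanSpace ℝ (Fin 2)} (hp : p ∈ V) (htc : ContinuousOn t V)
    {q : EuclideanSpace ℝ (Fin 2)}
    (h : MapsTo (fun v : ↥V => t v) {(⟨p, hp⟩ : ↥V)}ᶜ ({q}ᶜ : Set (EuclideanSpace ℝ (Fin 2))))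
    {r : ℝ} (hr : 0 < r) (hrV : ι '' closedBall (ι.symm p) r ⊆ V) :
    relativeSingularHomology.map ℤ ℤ
        (⟨fun v : ↥V => t v, htc.restrict⟩ : C(↥V, EuclideanSpace ℝ (Fin 2))) h 2
        ((localHomology.openSubsetIso ℤ ℤ hV hp 2).inv (g.localClass p)) =
      wind (fun s => ι.symm (t (ι (circleLoop (ι.symm p) r s))) - ι.symm q) • g.localClass q := by
  -- read everything in `ℂ` through `ι`
  set c : ℂ := ι.symm p with hc
  set qc : ℂ := ι.symm q with hqc
  set tc : ℂ → ℂ := fun z => ι.symm (t (ι z)) with htc'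
  have hιc : ι c = p := ι.apply_symm_apply p
  have hne' : ∀ z, ι z ∈ V → z ≠ c → t (ι z) ≠ q := by
    intro z hz hzc htq
    refine h (x := ⟨ι z, hz⟩) (fun hm => hzc ?_) htq
    rw [mem_singleton_iff] at hm
    have : ι z = p := congrArg Subtype.val hm
    rw [hc, ← this, ι.symm_apply_apply]
  -- room: a larger closed disc inside `V`
  have hVc : IsOpen (ι ⁻¹' V) := hV.preimage ι.continuous
  have hsub : closedBall c r ⊆ ι ⁻¹' V := fun z hz => hrV (mem_image_of_mem ι hz)
  obtain ⟨δ, hδ, hδV⟩ := (isCompact_closedBall c r).exists_cthickening_subset_open hVc hsub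
  rw [cthickening_closedBall hδ.le hr.le] at hδV
  set R : ℝ := δ + r with hR
  have hrR : r < R := by rw [hR]; linarith
  -- `t` read in `ℂ` on the annulus `r ≤ ‖z - c‖ ≤ R`
  have htR : ContinuousOn tc (closedBall c R) := by
    refine ι.symm.continuous.comp_continuousOn (htc.comp ι.continuous.continuousOn fun z hz => ?_)
    exact hδV hz
  have htA : ContinuousOn tc {z : ℂ | r ≤ ‖z - c‖ ∧ ‖z - c‖ ≤ R} :=
    htR.mono fun z hz => mem_closedBall_iff_norm.2 hz.2
  have hneA : ∀ z, r ≤ ‖z - c‖ → ‖z - c‖ ≤ R → tc z ≠ qc := by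
    intro z hz hzR h0
    have hzc : z ≠ c := by
      intro e; rw [e, sub_self, norm_zero] at hz; exact not_lt.2 hz hr
    exact hne' z (hδV (mem_closedBall_iff_norm.2 hzR)) hzc (ι.symm.injective h0)
  obtain ⟨N, a, Mc, A, ha_inj, ha_lt, hMc, hMt, hMq, hMd, hAdet, hsum⟩ :=
    exists_planeModel hr hrR htA hneA
  -- transport the model to `ℝ²`
  set M : EuclideanSpace ℝ (Fin 2) → EuclideanSpace ℝ (Fin 2) := fun x => ι (Mc (ι.symm x)) with hM
  set O : Set (EuclideanSpace ℝ (Fin 2)) := ι.symm ⁻¹' ball c R with hO'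
  set K : Set (EuclideanSpace ℝ (Fin 2)) := ι.symm ⁻¹' closedBall c r with hK'
  have hO : IsOpen O := isOpen_ball.preimage ι.symm.continuous
  have hKeq : K = ι '' closedBall c r := by
    ext x
    simp only [hK', mem_preimage, mem_image]
    constructor
    · intro hx; exact ⟨ι.symm x, hx, ι.apply_symm_apply x⟩
    · rintro ⟨z, hz, rfl⟩; rwa [ι.symm_apply_apply]
  have hK : IsCompact K := by
    rw [hKeq]; exact (isCompact_closedBall c r).image ι.continuous
  have hKO : K ⊆ O := fun x hx =>
    mem_ball_iff_norm.2 ((mem_closedBall_iff_norm.1 (show ι.symm x ∈ closedBall c r from hx)).trans_lt hrR)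
  have hOV : O ⊆ V := fun x hx => by
    have := hδV (ball_subset_closedBall (show ι.symm x ∈ ball c R from hx))
    rwa [mem_preimage, ι.apply_symm_apply] at this
  have hpK : p ∈ K := by
    show ι.symm p ∈ closedBall c r
    rw [← hc]; exact mem_closedBall_self hr.le
  have hMcont : ContinuousOn M O :=
    ι.continuous.comp_continuousOn (hMc.comp ι.symm.continuous.continuousOn fun x hx => hx)
  have hMeq : ∀ x ∈ O, x ∉ K → M x = t x := by
    intro x hxO hxK
    have h1 : r ≤ ‖ι.symm x - c‖ :=
      le_of_not_gt fun hlt => hxK (show ι.symm x ∈ closedBall c r from mem_closedBall_iff_norm.2 hlt.le)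
    have h2 : ‖ι.symm x - c‖ < R := mem_ball_iff_norm.1 (show ι.symm x ∈ ball c R from hxO)
    show ι (Mc (ι.symm x)) = t x
    rw [hMt _ h1 h2]
    show ι (ι.symm (t (ι (ι.symm x)))) = t x
    rw [ι.apply_symm_apply, ι.apply_symm_apply]
  -- the preimages of `q` under `M`: the points `v j = ι (a j)`
  set v : Fin N → EuclideanSpace ℝ (Fin 2) := fun j => ι (a j) with hv
  have hvinj : Injective v := fun i j hij => ha_inj (ι.injective hij)
  have hvK : ∀ j, v j ∈ K := fun j => by
    show ι.symm (ι (a j)) ∈ closedBall c r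
    rw [ι.symm_apply_apply]
    exact mem_closedBall_iff_norm.2 ((ha_lt j).le.trans (by linarith))
  have hZ : ∀ x ∈ O, M x = q ↔ ∃ j, x = v j := by
    intro x hx
    have e1 : M x = q ↔ Mc (ι.symm x) = qc := by
      constructor
      · intro h0
        have := congrArg ι.symm h0
        rwa [hM, ι.symm_apply_apply] at this
      · intro h0
        show ι (Mc (ι.symm x)) = q
        rw [h0, hqc, ι.apply_symm_apply]
    rw [e1, hMq _ hx]
    refine exists_congr fun j => ?_
    rw [ContinuousLinearEquiv.symm_apply_eq]
  -- the derivatives at the preimages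
  set A' : Fin N → (EuclideanSpace ℝ (Fin 2) →L[ℝ] EuclideanSpace ℝ (Fin 2)) :=
    fun j => (ι : ℂ →L[ℝ] EuclideanSpace ℝ (Fin 2)) ∘L A j ∘L (ι.symm : EuclideanSpace ℝ (Fin 2) →L[ℝ] ℂ)
    with hA'
  have hA'd : ∀ j, HasFDerivAt M (A' j) (v j) := by
    intro j
    have h1 : HasFDerivAt Mc (A j) (ι.symm (v j)) := by
      rw [show ι.symm (v j) = a j from ι.symm_apply_apply (a j)]
      exact hMd j
    exact ι.hasFDerivAt.comp (v j) (h1.comp (v j) ι.symm.hasFDerivAt)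
  have hA'det : ∀ j, LinearMap.det (A' j : EuclideanSpace ℝ (Fin 2) →ₗ[ℝ] EuclideanSpace ℝ (Fin 2)) =
      LinearMap.det (A j : ℂ →ₗ[ℝ] ℂ) := fun j =>
    Literature.Topology.FourManifolds.det_conj_continuousLinearEquiv ι (A j)
  -- the class along `K` and the three homological steps
  obtain ⟨α, hα⟩ := exists_classAlong_of_isCompact (by norm_num : 1 ≤ 2) g hK
  have hmapsO_t : MapsTo (fun x : ↥O => t x) (Subtype.val ⁻¹' K)ᶜ ({q}ᶜ : Set (EuclideanSpace ℝ (Fin 2))) := by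
    intro x hx h0
    have hxp : (x : EuclideanSpace ℝ (Fin 2)) ≠ p := fun e => hx (show (x : EuclideanSpace ℝ (Fin 2)) ∈ K from e ▸ hpK)
    refine hne' (ι.symm x) ?_ (fun e => hxp ?_) ?_
    · rw [ι.apply_symm_apply]; exact hOV x.2
    · rw [← ι.apply_symm_apply (x : EuclideanSpace ℝ (Fin 2)), e, hιc]
    · rw [ι.apply_symm_apply]; exact h0
  have hmapsO_M : MapsTo (fun x : ↥O => M x) (Subtype.val ⁻¹' K)ᶜ ({q}ᶜ : Set (EuclideanSpace ℝ (Fin 2))) := by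
    intro x hx h0
    obtain ⟨j, hj⟩ := (hZ x x.2).1 h0
    exact hx (show (x : EuclideanSpace ℝ (Fin 2)) ∈ K from hj ▸ hvK j)
  have e1 := map_openSubsetIso_inv_localClass_eq_map_classAlong g hV hO hK hOV hKO hpK t htc q h
    hmapsO_t α (hα p hpK)
  have e2 := map_classAlong_eq_of_eqOn (K := K) t M (htc.mono hOV) hMcont hMeq q hmapsO_t hmapsO_M 2
  have e3 := map_classAlong_eq_sum_detSign_smul g hO hK hKO M hMcont q v hvinj hZ hvK A' hA'd
    (fun j => by rw [hA'det]; exact hAdet j) α (fun j => hα (v j) (hvK j)) hmapsO_M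
  rw [e1, e2, e3]
  congr 1
  rw [← hsum]
  exact Finset.sum_congr rfl fun j _ => by rw [hA'det]

end Main


end Literature.AlgebraicTopology.SingularHomology

end
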